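import Literature.Computability.AlgebraicComplexity.AndrewsForbes2022BorderLST
import Literature.Computability.AlgebraicComplexity.AndrewsForbes2022BorderComposition
import Literature.Computability.AlgebraicComplexity.AndrewsForbes2022Cor310Proofs
import Mathlib.Analysis.SpecialFunctions.Pow.Asymptotics

/-!
# Andrews–Forbes 2022, Lemma 6.6 (low-depth border lower bound for the determinantal ideal) — proofs

The named fact `AndrewsForbes2022_lemma_6_6` (`AndrewsForbes2022Applications.lean`; AF22 p0033:L33)
says: there is a universal `c > 0` such that for every nonzero `f ∈ I^det_{n,m,r}` with `char F = 0`
or `char F > deg f`, every product-depth-`Δ` circuit computing `f(X) + O(ε)` has (wire) size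
`≥ r^{(log r)^{exp(-cΔ)}}` (for `r ≥ r₀(Δ)`).  This file follows the printed proof (p0033:L44–L80):

1. `d := (log r)/1000` and a width `w` with `w(d-1)+2 ≤ r` (print: `w = r/log r`; here `w = ⌊√r⌋`,
   which only changes the absolute constant);
2. Cor. 3.10: from the size-`s` border circuit for `f`, one layer of `nm` affine gates below and one
   affine gate above give a border circuit for `IMM_{w,d}` — in the tree
   `borderClass_of_depthThreeOracleComputes` (`AndrewsForbes2022BorderComposition.lean`; wires
   `(s+1)(dw²+1)+s+2`, feeding only the `≤ s+1` variables the circuit reads, so the printed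
   WLOG-reduction of the support of `f`, p0033:L44–47, is not needed);
3. the border LST bound, Cor. 6.5, with its exponent made explicit
   (`AndrewsForbes2022_cor_6_5_explicit_mu`: `w^{d^{μ_Δ/4}} ≤ s'` once `d ≤ (log w)/100`,
   `μ_Δ ≥ 7^{-Δ}`), and the final arithmetic "`s + O(n²m²) ≥ w^{d^{exp(-O(Δ))}} =`
   `r^{(log r)^{exp(-O(Δ))}}`" with the universal constant `c = log 56`
   (`exp(-cΔ) = 56^{-Δ} ≤ μ_Δ/8`).

Results:
* `AndrewsForbes2022_lemma_6_6_core` — the engine, PROVED for every field, taking as hypothesis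
  exactly the conclusion of Cor. 3.10 for the polynomial `f` at hand (and `char F = 0 ∨ char F > r`);
* `AndrewsForbes2022_lemma_6_6_charZero` — **Lemma 6.6 for every field of characteristic `0`,
  PROVED** (Cor. 3.10 in char `0` is the tree's theorem `AndrewsForbes2022_cor_3_10_holds`).

What is still missing for the named fact BY NAME is only its positive-characteristic case
`char F > deg f`: the third bullet of Cor. 3.10 with `k = 0` (p0033:L69–L72: `deg f ≥ d p^k` and
`p > deg f` force `k = 0`; the tree's `AndrewsForbes2022_thm_3_8_posChar_holds` only yields `∃ k`).

Also recorded here, for the proof of Lemma 6.7 (p0034:L6, "`f` has degree at most `s^Δ`"):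
`support_subset_of_polyOrdGE_one_sub` / `totalDegree_le_of_polyOrdGE_one_sub` — if
`h = f + O(ε)` coefficientwise then every monomial of `f` occurs in `h`, so `deg f ≤ deg h`.

Theorem-only (no new definitions, no new named facts; D-0026).  Honest framing: a lower bound for an
explicit polynomial family against constant-depth circuits, as printed; VP ≠ VNP is NOT touched.

## References
* [AndrewsForbes2022] R. Andrews, M. A. Forbes, *Ideals, determinants, and straightening: proving and
  using lower bounds for polynomial ideals*, STOC 2022, arXiv:2112.00792 — Lemma 6.6 and its proof
  (p0033:L33–L80), Cor. 3.10 (p0024:L76), Cor. 6.5 (p0033:L25), Lemma 6.7 (p0034:L6).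
* [LimayeSrinivasanTavenas2025] N. Limaye, S. Srinivasan, S. Tavenas, *Superpolynomial lower bounds
  against low-depth algebraic circuits*, J. ACM 2025 — the exponents `μ_Δ`.
-/

noncomputable section

namespace Literature.Computability.AlgebraicComplexity

open MvPolynomial

section Support

variable {F : Type} [Field F]

/-- If `h = f + O(ε)` coefficientwise (`PolyOrdGE 1 (h - f)`), every monomial of `f` occurs in `h`
(the `ε⁰`-coefficient of `coeff_m h` is `coeff_m f`).  Used in the proof of Lemma 6.7 ("`f` has
degree at most `s^Δ`", p0034:L6). [cite: AndrewsForbes2022, Lemma 6.7 (proof)] -/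
theorem support_subset_of_polyOrdGE_one_sub {σ : Type} {f : MvPolynomial σ F}
    {h : MvPolynomial σ (LaurentSeries F)}
    (hh : PolyOrdGE 1 (h - MvPolynomial.map (algebraMap F (LaurentSeries F)) f)) :
    f.support ⊆ h.support := by
  intro m hm
  rw [MvPolynomial.mem_support_iff] at hm ⊢
  intro h0
  have := hh m 0 (by norm_num)
  rw [MvPolynomial.coeff_sub, MvPolynomial.coeff_map, h0, zero_sub, HahnSeries.coeff_neg,
    algebraMap_laurentSeries_apply, HahnSeries.C_apply, HahnSeries.coeff_single_same,
    neg_eq_zero] at this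
  exact hm this

/-- **`deg f ≤ deg h` for `h = f + O(ε)`** (proof of Lemma 6.7, p0034:L6: a polynomial in the
closure of size-`s` product-depth-`Δ` circuits has degree `≤ s^Δ`, the degree bound of the
approximating circuit). [cite: AndrewsForbes2022, Lemma 6.7 (proof)] -/
theorem totalDegree_le_of_polyOrdGE_one_sub {σ : Type} {f : MvPolynomial σ F}
    {h : MvPolynomial σ (LaurentSeries F)}
    (hh : PolyOrdGE 1 (h - MvPolynomial.map (algebraMap F (LaurentSeries F)) f)) :
    f.totalDegree ≤ h.totalDegree :=
  Finset.sup_mono (support_subset_of_polyOrdGE_one_sub hh)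

end Support

end Literature.Computability.AlgebraicComplexity

namespace Literature.Computability.AlgebraicComplexity

open MvPolynomial LSTWord BorderLST Real Filter Topology

namespace BorderLST

/-- The parameter regime of the proof of Lemma 6.6 ("When `r` is sufficiently large", p0033:L77):
eventually in `r`, with `d = ⌊(log r)/1000⌋` and `ρ = r^{1/10}`, all the (finitely many) threshold
inequalities used below hold. [cite: AndrewsForbes2022, Lemma 6.6 (proof)] -/
theorem lemma_6_6_eventually (d₀ : ℕ) {μ : ℝ} (hμ : 0 < μ) :
    ∃ r₀ : ℕ, ∀ r : ℕ, r₀ ≤ r →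
      2000 ≤ Real.log r ∧ d₀ ≤ ⌊Real.log r / 1000⌋₊ ∧
      8 ≤ ((⌊Real.log r / 1000⌋₊ : ℕ) : ℝ) ^ (μ / 4) ∧
      10000 ≤ (Real.log r) ^ (μ / 8) ∧
      Real.log r ≤ (r : ℝ) ^ (1 / 10 : ℝ) ∧ 2 ≤ (r : ℝ) ^ (1 / 10 : ℝ) := by
  have hlog : Tendsto (fun r : ℕ => Real.log r) atTop atTop :=
    Real.tendsto_log_atTop.comp tendsto_natCast_atTop_atTop
  have hd : Tendsto (fun r : ℕ => ⌊Real.log r / 1000⌋₊) atTop atTop :=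
    tendsto_nat_floor_atTop.comp (hlog.atTop_div_const (by norm_num))
  have hE : Tendsto (fun r : ℕ => ((⌊Real.log r / 1000⌋₊ : ℕ) : ℝ) ^ (μ / 4)) atTop atTop :=
    (tendsto_rpow_atTop (by positivity)).comp (tendsto_natCast_atTop_atTop.comp hd)
  have hL : Tendsto (fun r : ℕ => (Real.log r) ^ (μ / 8)) atTop atTop :=
    (tendsto_rpow_atTop (by positivity)).comp hlog
  have hρ : Tendsto (fun r : ℕ => (r : ℝ) ^ (1 / 10 : ℝ)) atTop atTop :=
    (tendsto_rpow_atTop (by norm_num)).comp tendsto_natCast_atTop_atTop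
  have h5 : ∀ᶠ r : ℕ in atTop, Real.log r ≤ (r : ℝ) ^ (1 / 10 : ℝ) := by
    have hlo := (isLittleO_log_rpow_atTop (by norm_num : (0 : ℝ) < 1 / 10)).bound one_pos
    filter_upwards [tendsto_natCast_atTop_atTop.eventually hlo] with r hr
    rw [one_mul, Real.norm_eq_abs, Real.norm_eq_abs,
      abs_of_nonneg (Real.rpow_nonneg (Nat.cast_nonneg r) _)] at hr
    exact (le_abs_self _).trans hr
  obtain ⟨r₀, hr₀⟩ := Filter.eventually_atTop.1 ((hlog.eventually_ge_atTop 2000).and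
    ((hd.eventually_ge_atTop d₀).and ((hE.eventually_ge_atTop 8).and
    ((hL.eventually_ge_atTop 10000).and (h5.and (hρ.eventually_ge_atTop 2))))))
  exact ⟨r₀, fun r hr => hr₀ r hr⟩

/-- `exp(-(log 56) Δ) = 56^{-Δ} ≤ 7^{-Δ}/8 ≤ μ_Δ/8` for `Δ ≥ 1`: the universal constant of
Lemma 6.6 against the explicit LST exponent. [cite: AndrewsForbes2022, Lemma 6.6 (proof)] -/
theorem exp_neg_log56_le_mu {Δ : ℕ} (hΔ : 1 ≤ Δ) :
    Real.exp (-(Real.log 56 * Δ)) ≤ mu Δ / 8 := by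
  have h56 : Real.exp (-(Real.log 56 * Δ)) = ((56 : ℝ) ^ Δ)⁻¹ := by
    rw [Real.exp_neg, mul_comm, Real.exp_nat_mul, Real.exp_log (by norm_num)]
  rw [h56]
  have h7 := pow_inv_seven_le_mu Δ
  have hsplit : ((56 : ℝ) ^ Δ)⁻¹ = ((8 : ℝ) ^ Δ)⁻¹ * (1 / 7 : ℝ) ^ Δ := by
    rw [show (56 : ℝ) = 8 * 7 by norm_num, mul_pow, mul_inv, one_div, inv_pow]
  rw [hsplit]
  have h8 : ((8 : ℝ) ^ Δ)⁻¹ ≤ 1 / 8 := by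
    rw [one_div]
    exact inv_anti₀ (by norm_num) (by
      calc (8 : ℝ) = 8 ^ 1 := (pow_one _).symm
        _ ≤ 8 ^ Δ := pow_le_pow_right₀ (by norm_num) hΔ)
  calc ((8 : ℝ) ^ Δ)⁻¹ * (1 / 7 : ℝ) ^ Δ ≤ 1 / 8 * mu Δ :=
        mul_le_mul h8 h7 (by positivity) (by norm_num)
    _ = mu Δ / 8 := by ring

/-- The arithmetic of the proof of Lemma 6.6 (p0033:L60–L80), isolated: in the eventual regime of
`lemma_6_6_eventually`, with `d = ⌊(log r)/1000⌋`, `w = ⌊√r⌋` and `E = d^{μ/4} ≥ 8`, the LST bound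
`w^E ≤ (s+1)(d w² + 1) + s + 2` forces `r^{(log r)^{e^{-cΔ}}} ≤ s` (`c = log 56`).
[cite: AndrewsForbes2022, Lemma 6.6 (proof)] -/
theorem lemma_6_6_arith {μ c : ℝ} (hμ : 0 < μ) (hμ1 : μ ≤ 1) {Δ : ℕ} (hc : Real.exp (-(c * Δ)) ≤ μ / 8)
    {r d w s : ℕ} (hdr : d = ⌊Real.log r / 1000⌋₊)
    (hlog : 2000 ≤ Real.log r) (hE : 8 ≤ (d : ℝ) ^ (μ / 4)) (hL : 10000 ≤ (Real.log r) ^ (μ / 8))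
    (hρ2 : 2 ≤ (r : ℝ) ^ (1 / 10 : ℝ)) (hw : ((r : ℝ) ^ (1 / 10 : ℝ)) ^ 4 ≤ w) (hdw : d + 1 ≤ w)
    (hmain : (w : ℝ) ^ ((d : ℝ) ^ (μ / 4)) ≤ (((s + 1) * (d * (w * w) + 1) + s + 2 : ℕ) : ℝ)) :
    (r : ℝ) ^ ((Real.log r) ^ Real.exp (-(c * Δ))) ≤ s := by
  -- notation
  obtain ⟨ρ, hρ⟩ : ∃ ρ : ℝ, ρ = (r : ℝ) ^ (1 / 10 : ℝ) := ⟨_, rfl⟩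
  obtain ⟨E, hEdef⟩ : ∃ E : ℝ, E = (d : ℝ) ^ (μ / 4) := ⟨_, rfl⟩
  obtain ⟨ℓ, hℓ⟩ : ∃ ℓ : ℝ, ℓ = Real.log r := ⟨_, rfl⟩
  rw [← hρ] at hρ2 hw
  rw [← hEdef] at hE hmain
  rw [← hℓ] at hlog hL hdr ⊢
  have hr0 : (0 : ℝ) ≤ r := Nat.cast_nonneg r
  have hρr : ρ ^ (10 : ℕ) = r := by
    rw [hρ, ← Real.rpow_natCast, ← Real.rpow_mul hr0]; norm_num
  have hr1 : (1 : ℝ) ≤ r := by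
    rw [← hρr]; exact one_le_pow₀ (by linarith)
  have hρ4 : (16 : ℝ) ≤ ρ ^ 4 := by nlinarith [pow_le_pow_left₀ (by norm_num : (0:ℝ) ≤ 2) hρ2 4]
  have hW16 : (16 : ℝ) ≤ w := hρ4.trans hw
  have hW0 : (0 : ℝ) < w := by linarith
  have hw2 : 2 ≤ w := by exact_mod_cast (show (2 : ℝ) ≤ w by linarith)
  -- `(s+1)(d w² + 1) + s + 2 ≤ (s+1) w³`
  have hS : (s + 1) * (d * (w * w) + 1) + s + 2 ≤ (s + 1) * (w * w * w) := by
    have h3 : 3 ≤ w * w := by nlinarith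
    have h4 : d * (w * w) + 3 ≤ w * w * w := by
      have := Nat.mul_le_mul_right (w * w) hdw
      nlinarith
    nlinarith
  have hmain' : (w : ℝ) ^ E ≤ ((s : ℝ) + 1) * (w : ℝ) ^ (3 : ℝ) := by
    refine hmain.trans ?_
    have : (((s + 1) * (d * (w * w) + 1) + s + 2 : ℕ) : ℝ) ≤ (((s + 1) * (w * w * w) : ℕ) : ℝ) := by
      exact_mod_cast hS
    refine this.trans (le_of_eq ?_)
    rw [show (3 : ℝ) = ((3 : ℕ) : ℝ) by norm_num, Real.rpow_natCast]
    push_cast; ring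
  -- `w^{E-3} ≤ s + 1`, `w^{E-4} ≤ s`
  have hE3 : (w : ℝ) ^ (E - 3) ≤ (s : ℝ) + 1 := by
    rw [Real.rpow_sub hW0, div_le_iff₀ (Real.rpow_pos_of_pos hW0 _)]
    exact hmain'
  have hE4 : (w : ℝ) ^ (E - 4) ≤ s := by
    have hsplit : (w : ℝ) ^ (E - 3) = (w : ℝ) ^ (E - 4) * w := by
      rw [show E - 3 = (E - 4) + 1 by ring, Real.rpow_add hW0, Real.rpow_one]
    have h1 : (1 : ℝ) ≤ (w : ℝ) ^ (E - 4) := Real.one_le_rpow (by linarith) (by linarith)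
    nlinarith
  -- `r^{E/5} ≤ w^{E-4}`
  have hρE : (r : ℝ) ^ (E / 5) ≤ (w : ℝ) ^ (E - 4) := by
    have h1 : (r : ℝ) ^ (E / 5) ≤ (r : ℝ) ^ ((2 / 5 : ℝ) * (E - 4)) :=
      Real.rpow_le_rpow_of_exponent_le hr1 (by linarith)
    refine h1.trans ?_
    have h2 : (ρ ^ 4) ^ (E - 4) = (r : ℝ) ^ ((2 / 5 : ℝ) * (E - 4)) := by
      have : ρ ^ 4 = (r : ℝ) ^ (2 / 5 : ℝ) := by
        rw [hρ, ← Real.rpow_natCast, ← Real.rpow_mul hr0]; norm_num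
      rw [this, ← Real.rpow_mul hr0]
    rw [← h2]
    exact Real.rpow_le_rpow (by positivity) hw (by linarith)
  -- `(log r)^{exp(-cΔ)} ≤ E/5`
  have hℓ1 : (1 : ℝ) ≤ ℓ := by linarith
  have hd : ℓ / 2000 ≤ d := by
    have hfl : (ℓ / 1000 : ℝ) - 1 < (⌊ℓ / 1000⌋₊ : ℕ) := Nat.sub_one_lt_floor _
    rw [← hdr] at hfl
    linarith
  have hexp : ℓ ^ Real.exp (-(c * Δ)) ≤ E / 5 := by
    have h1 : ℓ ^ Real.exp (-(c * Δ)) ≤ ℓ ^ (μ / 8) := Real.rpow_le_rpow_of_exponent_le hℓ1 hc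
    refine h1.trans ?_
    have h2 : ℓ ^ (μ / 4) = ℓ ^ (μ / 8) * ℓ ^ (μ / 8) := by
      rw [← Real.rpow_add (by linarith)]; ring_nf
    have h3 : (ℓ / 2000) ^ (μ / 4) ≤ E := by
      rw [hEdef]; exact Real.rpow_le_rpow (by positivity) hd (by positivity)
    have h4 : (ℓ / 2000) ^ (μ / 4) = ℓ ^ (μ / 4) / (2000 : ℝ) ^ (μ / 4) := by
      rw [Real.div_rpow (by linarith) (by norm_num)]
    have h5 : (2000 : ℝ) ^ (μ / 4) ≤ 2000 := by
      calc (2000 : ℝ) ^ (μ / 4) ≤ (2000 : ℝ) ^ (1 : ℝ) :=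
            Real.rpow_le_rpow_of_exponent_le (by norm_num) (by linarith)
        _ = 2000 := Real.rpow_one _
    have h2000 : (0 : ℝ) < (2000 : ℝ) ^ (μ / 4) := by positivity
    have h6 : ℓ ^ (μ / 4) ≤ 2000 * E := by
      have := h3; rw [h4, div_le_iff₀ h2000] at this
      nlinarith [Real.rpow_nonneg (by linarith : (0 : ℝ) ≤ ℓ) (μ / 4), hE]
    have h7 : (0 : ℝ) ≤ ℓ ^ (μ / 8) := Real.rpow_nonneg (by linarith) _
    nlinarith
  -- conclusion
  calc (r : ℝ) ^ (ℓ ^ Real.exp (-(c * Δ))) ≤ (r : ℝ) ^ (E / 5) :=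
        Real.rpow_le_rpow_of_exponent_le hr1 hexp
    _ ≤ (w : ℝ) ^ (E - 4) := hρE
    _ ≤ s := hE4

end BorderLST

open scoped RatFunc LaurentSeries in
/-- **Andrews–Forbes 2022, Lemma 6.6 — the engine, PROVED modulo the `IMM`-projection of Cor. 3.10
for the polynomial at hand** (the printed proof, p0033:L44–L80, verbatim: `d = (log r)/1000`, a width
`w` with `w(d-1)+2 ≤ r` — here `w = ⌊√r⌋`, which only changes the constant —, Cor. 3.10 turns a
border circuit for `f` into one for `IMM_{w,d}` by one layer of affine gates below and one above
(`borderClass_of_depthThreeOracleComputes`: wires `(s+1)(dw²+1)+s+2`), and the border LST bound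
Cor. 6.5 with the explicit exponent `μ_Δ/4` (`AndrewsForbes2022_cor_6_5_explicit_mu`) gives
`r^{(log r)^{exp(-cΔ)}} ≤ s` for `r ≥ r₀(Δ)`, with the universal `c = log 56`).  The hypothesis
`H310` is exactly the conclusion of Cor. 3.10 for `f` (char `0`: `AndrewsForbes2022_cor_3_10_holds`;
char `p > deg f`: the third bullet with `k = 0`, p0033:L69–L72); the characteristic enters only
through `char F = 0 ∨ char F > r ≥ d` for Cor. 6.5.  (The printed WLOG-reduction of the support of
`f`, p0033:L44–47, is not needed: the affine layer only feeds the `≤ s + 1` variables the circuit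
reads.) [cite: AndrewsForbes2022, Lemma 6.6 (proof)] -/
theorem AndrewsForbes2022_lemma_6_6_core :
    ∃ c : ℝ, 0 < c ∧ ∀ Δ : ℕ, 1 ≤ Δ → ∃ r₀ : ℕ, ∀ (F : Type) [Field F] (σ : Type) [DecidableEq σ]
      (r : ℕ), r₀ ≤ r → (ringChar F = 0 ∨ r < ringChar F) →
      ∀ f : MvPolynomial σ F,
        (∀ h : MvPolynomial σ (LaurentSeries F),
            PolyOrdGE 1 (h - MvPolynomial.map (algebraMap F (LaurentSeries F)) f) →
          ∀ (w d : ℕ) [NeZero w], w * (d - 1) + 2 ≤ r →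
            DepthThreeOracleComputes h
              (MvPolynomial.map (algebraMap F (LaurentSeries F)) (imm11Poly w d F))) →
      ∀ s : ℕ, f ∈ borderClass F (productDepthEdgeClass (LaurentSeries F) σ s Δ) →
        (r : ℝ) ^ ((Real.log r) ^ Real.exp (-(Real.log 56 * Δ))) ≤ s := by
  classical
  refine ⟨Real.log 56, Real.log_pos (by norm_num), fun Δ hΔ => ?_⟩
  obtain ⟨d₀, H65⟩ := AndrewsForbes2022_cor_6_5_explicit_mu hΔ
  have hμ : 0 < mu Δ := mu_pos Δ
  have hμ1 : mu Δ ≤ 1 := mu_le_one Δ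
  obtain ⟨r₀, hr₀⟩ := BorderLST.lemma_6_6_eventually d₀ hμ
  refine ⟨r₀, fun F _ σ _ r hr hchar f H310 s hs => ?_⟩
  obtain ⟨hlog, hd₀, hE, hL, hℓρ, hρ2⟩ := hr₀ r hr
  -- the parameters `d = ⌊(log r)/1000⌋`, `w = ⌊√r⌋`
  obtain ⟨d, hdr⟩ : ∃ d : ℕ, d = ⌊Real.log r / 1000⌋₊ := ⟨_, rfl⟩
  obtain ⟨w, hwr⟩ : ∃ w : ℕ, w = Nat.sqrt r := ⟨_, rfl⟩
  rw [← hdr] at hd₀ hE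
  obtain ⟨ρ, hρ⟩ : ∃ ρ : ℝ, ρ = (r : ℝ) ^ (1 / 10 : ℝ) := ⟨_, rfl⟩
  rw [← hρ] at hℓρ hρ2
  have hr0 : (0 : ℝ) ≤ r := Nat.cast_nonneg r
  have hρ0 : (0 : ℝ) ≤ ρ := by linarith
  have hρr : ρ ^ (10 : ℕ) = r := by
    rw [hρ, ← Real.rpow_natCast, ← Real.rpow_mul hr0]; norm_num
  -- `w ≥ ρ^5 - 1 ≥ ρ^4`
  have hw5 : ρ ^ 5 - 1 ≤ w := by
    have hlt : (r : ℝ) < ((w : ℝ) + 1) ^ 2 := by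
      rw [hwr]; exact_mod_cast Nat.lt_succ_sqrt' r
    rw [← hρr, show ρ ^ (10 : ℕ) = (ρ ^ 5) ^ 2 by ring] at hlt
    have := lt_of_pow_lt_pow_left₀ 2 (by positivity) hlt
    linarith
  have hw4 : ρ ^ 4 ≤ w := by
    have : ρ ^ 4 * (ρ - 1) - 1 ≥ ρ ^ 4 := by nlinarith [pow_le_pow_left₀ (by norm_num : (0:ℝ) ≤ 2) hρ2 4]
    nlinarith
  have hρ4 : (16 : ℝ) ≤ ρ ^ 4 := by nlinarith [pow_le_pow_left₀ (by norm_num : (0:ℝ) ≤ 2) hρ2 4]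
  have hW16 : (16 : ℝ) ≤ w := hρ4.trans hw4
  have hw2 : 2 ≤ w := by exact_mod_cast (show (2 : ℝ) ≤ w by linarith)
  haveI : NeZero w := NeZero.of_pos (by omega)
  -- `d ≤ (log r)/1000 ≤ ρ/1000`, so `d + 1 ≤ w`
  have hdle : (d : ℝ) ≤ Real.log r / 1000 := by
    rw [hdr]; exact Nat.floor_le (by positivity)
  have hdw : d + 1 ≤ w := by
    have h1 : (d : ℝ) + 1 ≤ ρ ^ 4 := by
      have : ρ ≤ ρ ^ 4 := by nlinarith [pow_le_pow_left₀ (by norm_num : (0:ℝ) ≤ 2) hρ2 3]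
      nlinarith
    exact_mod_cast (show ((d + 1 : ℕ) : ℝ) ≤ w by push_cast; linarith)
  -- `w (d-1) + 2 ≤ r`
  have hwd : w * (d - 1) + 2 ≤ r := by
    have hww : w * w ≤ r := by rw [hwr]; exact Nat.sqrt_le r
    have h1 : w * (d - 1) ≤ w * (w - 2) := Nat.mul_le_mul_left _ (by omega)
    have h2 : w * (w - 2) + 2 ≤ w * w := by
      obtain ⟨v, rfl⟩ : ∃ v, w = v + 2 := ⟨w - 2, by omega⟩
      rw [Nat.add_sub_cancel]; nlinarith
    omega
  -- `d ≤ (log w)/100`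
  have hdlogw : (d : ℝ) ≤ Real.log w / 100 := by
    have hρpos : 0 < ρ := by linarith
    have h1 : Real.log ρ = Real.log r / 10 := by
      rw [hρ, Real.log_rpow (by
        have : (0 : ℝ) < ρ ^ (10 : ℕ) := by positivity
        rwa [hρr] at this)]
      ring
    have h2 : Real.log ρ ≤ Real.log w :=
      Real.log_le_log hρpos (le_trans (by nlinarith [pow_le_pow_left₀ (by norm_num : (0:ℝ) ≤ 2) hρ2 3]) hw4)
    linarith
  -- characteristic
  have hchar' : ringChar F = 0 ∨ d < ringChar F := by
    rcases hchar with h0 | hp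
    · exact Or.inl h0
    · right
      have : d ≤ r := by
        have := Nat.sqrt_le_self r; omega
      omega
  -- Cor. 3.10 and the composition
  obtain ⟨h, hh, hord⟩ := hs
  have h310 := H310 h hord w d hwd
  have hmem := borderClass_of_depthThreeOracleComputes hh h310
  have hcard : Fintype.card (Fin d × Fin w × Fin w) = d * (w * w) := by
    simp only [Fintype.card_prod, Fintype.card_fin]
  rw [hcard] at hmem
  -- the border LST bound
  have hbound := H65 F w d hd₀ hdlogw hchar' _ hmem
  exact BorderLST.lemma_6_6_arith hμ hμ1 (BorderLST.exp_neg_log56_le_mu hΔ) hdr hlog hE hL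
    (by rw [← hρ]; exact hρ2) (by rw [← hρ]; exact hw4) hdw (by exact_mod_cast hbound)

open scoped RatFunc LaurentSeries in
/-- **Andrews–Forbes 2022, Lemma 6.6 in characteristic zero — PROVED** (p0033:L33): there is a
universal `c > 0` (`c = log 56`) such that for every `Δ ≥ 1` there is `r₀` with: for every field `F`
of characteristic `0`, every nonzero `f ∈ I^det_{n,m,r}` with `r ≥ r₀`, and every `s`, if `f` is in
the closure of wire-size-`s` product-depth-`Δ` circuits then `r^{(log r)^{exp(-cΔ)}} ≤ s`.  This is
the `char F = 0` slice of the named fact `AndrewsForbes2022_lemma_6_6` (whose remaining case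
`char F > deg f` needs the third bullet of Cor. 3.10 with `k = 0`, not yet in the tree), by
`AndrewsForbes2022_lemma_6_6_core` and `AndrewsForbes2022_cor_3_10_holds`.
[cite: AndrewsForbes2022, Lemma 6.6] -/
theorem AndrewsForbes2022_lemma_6_6_charZero :
    ∃ c : ℝ, 0 < c ∧ ∀ Δ : ℕ, 1 ≤ Δ → ∃ r₀ : ℕ, ∀ (F : Type) [Field F] [CharZero F] (n m r : ℕ),
      r₀ ≤ r → ∀ f : MvPolynomial (Fin n × Fin m) F, f ∈ detIdeal F n m r → f ≠ 0 →
      ∀ s : ℕ, f ∈ borderClass F (productDepthEdgeClass (LaurentSeries F) _ s Δ) →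
        (r : ℝ) ^ ((Real.log r) ^ Real.exp (-(c * Δ))) ≤ s := by
  obtain ⟨c, hc, H⟩ := AndrewsForbes2022_lemma_6_6_core
  refine ⟨Real.log 56, Real.log_pos (by norm_num), fun Δ hΔ => ?_⟩
  obtain ⟨r₀, hr₀⟩ := H Δ hΔ
  refine ⟨r₀, fun F _ _ n m r hr f hf hf0 s hs => ?_⟩
  exact hr₀ F (Fin n × Fin m) r hr (Or.inl ((CharP.ringChar_zero_iff_CharZero F).mpr inferInstance)) f
    (fun h hh w d _ hwd => AndrewsForbes2022_cor_3_10_holds F n m r f hf hf0 h hh w d hwd) s hs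

end Literature.Computability.AlgebraicComplexity
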